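import Literature.Analysis.FluidPDE.ForwardDSSExistenceLocal
import HarnessLib

/-!
# Forward DSS solutions: the DSS-free analytic core of Bradshaw–Tsai 2019, §4.3

Analysis/FluidPDE fact file, companion of `ForwardDSSExistence.lean` (architecture of
Bradshaw–Tsai, Analysis & PDE 12 (2019) = arXiv:1801.08060, Thm 1.2) and
`ForwardDSSExistenceLocal.lean` (its localisation: the named fact
`bradshawTsai2019_limit_4_3_local` — the passage to the limit of §4.3 with `λ`-DSS approximating
pressures, concluding on the unit cylinder — and the proved re-scaling argument).

`bradshawTsai2019_limit_4_3_local` still mixes two things of a different nature: a standard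
compactness-and-stability statement for local Leray solutions with uniform bounds on the cylinder
`(0, T) × B₁` ("As usual (cf. [BT1, KiSe, LR2]), there exists a distribution `v` and a subsequence
… converging … in `L²(0,T;L²(B₁))` …; `πₖ` … converges weakly …; for compact subsets `K` of `B₁`,
we automatically have `lim_{t→0⁺} ‖v − v₀‖_{L²(K)} = 0` …; the local energy inequality for `v`
plainly follows", arXiv p. 12), in which discrete self-similarity plays no role, and the DSS
bookkeeping which turns the limit classes on the cylinder into a `λ`-DSS *pair of functions* on
`ℝ × ℝ³` (§4.2 "if a solution is DSS in a neighborhood of the origin, then it can be extended";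
in the tree's pointwise rendering of DSS this is a choice of scaling-invariant representatives of
the limit velocity and pressure, compatible with the every-`t` datum clause). This file vendors
the first as the named fact `bradshawTsai2019_cylinderLimit`, **free of any self-similarity**; the
second is *proved* in the companion proof files (`ForwardDSSCylinderLimitProofs*.lean`:
`bradshawTsai2019_limit_4_3_local_of_cylinderLimit :
bradshawTsai2019_cylinderLimit → bradshawTsai2019_limit_4_3_local`), so that the trust base of
Theorem 1.2 (`bradshawTsai2019_dss_existence_of_local_parts`) becomes Lemma 4.1, Prop. 3.1 (dss)
and this DSS-free compactness statement, whose printed proof is Lemarié-Rieusset's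
(Rellich–Lions compactness, convergence of weak solutions with lower semicontinuity of the
dissipation, continuity of the limit at `t = 0` in local `L²`: *The Navier–Stokes problem in the
21st century*, Thm 12.1, Thm 6.2, proof of Thm 14.1 Steps 3–4, Prop. 14.1).

## Design notes

* Hypotheses: exactly what §4.3 has in hand after Lemma 4.1, [BT1] and Prop. 3.1, minus
  everything DSS — measurable data `w₀⁽ᵏ⁾ → v₀` in `L²(B₁)` (`v₀ ∈ L²_loc` measurable), local
  Leray solutions `(vₖ, πₖ)` with these data (`IsLocalLeraySolution`, viscosity `1`), and the three
  bounds of Prop. 3.1 on `(0,T) × B₁` uniformly in `k` (same shape as in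
  `bradshawTsai2019_limit_4_3`). Local square integrability of the data, used by the printed
  argument, follows from `IsLocalLeraySolution.initial`/`.uniformLocalEnergy` and is not repeated.
* Conclusion: a subsequence `σ` and a pair `(u, p)` — some representatives of the limit classes —
  with: `(u, p)` a suitable weak solution (CKN) on the *open* cylinder
  `timeCylinder unitBall 0 T = (0,T) × B₁` (test functions compactly supported inside, where the
  uniform bounds give the local energy inequality "(cf. [CKN])"); the three bounds with the same
  constant `C` (the printed use of the weak-star `L^∞L²` / weak `L²H¹` / weak `L^{3/2}`
  convergences: lower semicontinuity); strong convergence `v_{σ(j)} → u` in `L²((0,T) × B₁)` and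
  weak convergence `π_{σ(j)} ⇀ p` in `L^{3/2}((0,T) × B₁)` tested against its dual `L³` (the two
  convergences the DSS bookkeeping consumes; the weak(-star) convergences of the velocities are
  otherwise omitted — a weakening); and the printed datum clause for compact `K ⊆ B₁`, for the
  representative `u` and every `t → 0⁺` (as in `IsLocalLeraySolution.initial`).
* `E = ℝ³` as in the source and in `ForwardDSSExistence.lean`.

## References

* Z. Bradshaw, T.-P. Tsai, Analysis & PDE 12 (2019) 1943–1962 = arXiv:1801.08060, §4.3 (proof of
  Thm 1.2, p. 12) [BradshawTsai2019].
* P. G. Lemarié-Rieusset, *The Navier–Stokes problem in the 21st century*, 2nd ed. (2023): Thm 6.2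
  (convergence of weak solutions), Thm 12.1 (Rellich–Lions), Thm 14.1 (proof, Steps 3–4),
  Prop. 14.1 (continuity of the limit at `t = 0` in local `L²`) [Lemarierieusset2023]; the "[LR2]"
  of the source is the 1st ed. (2016).
* L. Caffarelli, R. Kohn, L. Nirenberg, CPAM 35 (1982), §2 [CaffarelliKohnNirenberg1982].
-/

noncomputable section

open MeasureTheory Set Function Filter Metric
open scoped NNReal ENNReal Topology

namespace Literature.Analysis.FluidPDE

/-- Local notation for physical space `ℝ³ = EuclideanSpace ℝ (Fin 3)`. -/
local notation "ℝ³" => EuclideanSpace ℝ (Fin 3)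

/-- **Bradshaw–Tsai 2019, §4.3 (proof of Thm 1.2): the passage to the limit on the unit cylinder,
without the self-similar bookkeeping.** In print (arXiv:1801.08060 p. 12): "`vₖ` are uniformly
bounded in `L^∞(0,T;L²(B₁)) ∩ L²(0,T;H¹(B₁))` … As usual (cf. [BT1, KiSe, LR2]), there exists a
distribution `v` and a subsequence of `{vₖ}` … so that `vₖ` converges to `v` in the weak star
topology on `L^∞(0,T;L²(B₁))`, in the weak topology on `L²(0,T;H¹(B₁))`, and in
`L²(0,T;L²(B₁))` … `πₖ` are uniformly bounded in `L^{3/2}(0,T;L^{3/2}(B₁))` … we may extract a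
subsequence which converges weakly to a distribution `π ∈ L^{3/2}(0,T;L^{3/2}(B₁))` … For compact
subsets `K` of `B₁`, we automatically have `lim_{t→0⁺} ‖v − v₀‖_{L²(K)} = 0` … each `vₖ` satisfies
the local energy inequality … the right hand sides … converge to the right hand side of the energy
inequality for `v` … while the left hand-sides are lower semi-continuous (cf. [CKN]). The local
energy inequality for `v` plainly follows." Rendered for local Leray solutions `(vₖ, πₖ)`
(viscosity `1`) with measurable data `w₀⁽ᵏ⁾ → v₀` in `L²(B₁)` (`v₀ ∈ L²_loc` measurable) obeying,
for some `T > 0` and `C`, `esssup_{0<t<T} ∫_{B₁}|vₖ(t)|² ≤ C`, `∫∫_{(0,T)×B₁} |∇vₖ|² ≤ C` (a weak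
spatial gradient on the slab) and `∫∫_{(0,T)×B₁} |πₖ|^{3/2} ≤ C` uniformly in `k`: there are a
subsequence `σ` and a pair `(u, p)` which is a suitable weak solution (CKN) on the open cylinder
`(0,T) × B₁` with the same three bounds, such that `v_{σ(j)} → u` in `L²((0,T) × B₁)`,
`π_{σ(j)} ⇀ p` weakly in `L^{3/2}((0,T) × B₁)` (tested against `L³`), and `∫_K |u(t) − v₀|² → 0`
as `t → 0⁺` for every compact `K ⊆ B₁`. The printed proof is Lemarié-Rieusset's: Rellich–Lions
compactness (LR Thm 12.1), convergence of weak solutions with lower semicontinuity of the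
dissipation (LR Thm 6.2; proof of Thm 14.1, Steps 3–4), continuity of the limit at `t = 0` in
local `L²` (LR Prop. 14.1). See the module docstring for what is kept and what is omitted. [cite: BradshawTsai2019, §4.3 (proof of Thm 1.2, arXiv p. 12) "As usual (cf. [BT1, KiSe, LR2]) …"; proof as in Lemarierieusset2023 Thm 6.2, Thm 12.1, Thm 14.1 (Steps 3–4), Prop 14.1] -/
def bradshawTsai2019_cylinderLimit : Prop :=
  ∀ {v₀ : ℝ³ → ℝ³}, AEStronglyMeasurable v₀ volume →
    LocallyIntegrable (fun x => ‖v₀ x‖ ^ 2) volume →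
    ∀ {w₀ : ℕ → ℝ³ → ℝ³} {v : ℕ → ℝ → ℝ³ → ℝ³} {π : ℕ → ℝ → ℝ³ → ℝ} {T : ℝ} {C : ℝ≥0},
    (∀ k, AEStronglyMeasurable (w₀ k) volume) →
    Tendsto (fun k => ∫⁻ x in ball (0 : ℝ³) 1, ‖w₀ k x - v₀ x‖ₑ ^ 2) atTop (𝓝 0) →
    (∀ k, IsLocalLeraySolution 1 (w₀ k) (v k) (π k)) →
    0 < T →
    (∀ k, ∀ᵐ t ∂(volume.restrict (Ioo 0 T)), ∫⁻ x in ball (0 : ℝ³) 1, ‖v k t x‖ₑ ^ 2 ≤ C) →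
    (∀ k, ∃ G : ℝ → ℝ³ → ℝ³ →L[ℝ] ℝ³,
      HasWeakSpatialGradientOn (slab ℝ³ (Ioi 0) isOpen_Ioi) (v k) G ∧
      ∫⁻ z in Ioo 0 T ×ˢ ball (0 : ℝ³) 1, ENNReal.ofReal (frobeniusNormSq (G z.1 z.2)) ≤ C) →
    (∀ k, ∫⁻ z in Ioo 0 T ×ˢ ball (0 : ℝ³) 1, ‖π k z.1 z.2‖ₑ ^ (3 / 2 : ℝ) ≤ C) →
    ∃ (σ : ℕ → ℕ) (u : ℝ → ℝ³ → ℝ³) (p : ℝ → ℝ³ → ℝ), StrictMono σ ∧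
      IsSuitableWeakSolutionOn (timeCylinder unitBall 0 T) 1 0 u p ∧
      (∀ᵐ t ∂(volume.restrict (Ioo 0 T)), ∫⁻ x in ball (0 : ℝ³) 1, ‖u t x‖ₑ ^ 2 ≤ C) ∧
      (∃ G : ℝ → ℝ³ → ℝ³ →L[ℝ] ℝ³, HasWeakSpatialGradientOn (timeCylinder unitBall 0 T) u G ∧
        ∫⁻ z in Ioo 0 T ×ˢ ball (0 : ℝ³) 1, ENNReal.ofReal (frobeniusNormSq (G z.1 z.2)) ≤ C) ∧
      ∫⁻ z in Ioo 0 T ×ˢ ball (0 : ℝ³) 1, ‖p z.1 z.2‖ₑ ^ (3 / 2 : ℝ) ≤ C ∧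
      Tendsto (fun j => ∫⁻ z in Ioo 0 T ×ˢ ball (0 : ℝ³) 1, ‖v (σ j) z.1 z.2 - u z.1 z.2‖ₑ ^ 2)
        atTop (𝓝 0) ∧
      (∀ g : ℝ × ℝ³ → ℝ, MemLp g 3 (volume.restrict (Ioo 0 T ×ˢ ball (0 : ℝ³) 1)) →
        Tendsto (fun j => ∫ z in Ioo 0 T ×ˢ ball (0 : ℝ³) 1, π (σ j) z.1 z.2 * g z) atTop
          (𝓝 (∫ z in Ioo 0 T ×ˢ ball (0 : ℝ³) 1, p z.1 z.2 * g z))) ∧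
      (∀ K : Set ℝ³, IsCompact K → K ⊆ ball 0 1 →
        Tendsto (fun t => ∫⁻ x in K, ‖u t x - v₀ x‖ₑ ^ 2) (𝓝[>] 0) (𝓝 0))

end Literature.Analysis.FluidPDE

end
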